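import Summits.QuantumFields.YangMills.Theorems.FluctuationComparisonRegPrIntLS2BetaRelativeTowerSupBudgetTheta
import HarnessLib

/-!
# S2β · THE SUP CHAIN ∕ (D-stage): THE SUP BUDGET OF A TOWER SEGMENT — THE LATE-START EDITION OF ✓`exists_supBudget_128_theta`:
# the explicit guard `arc ≤ 1∕128` placed at ANY height `T₀` of an averaging tower (not at the datum) gives the θ-generic sup budget on the heights `t ≤ T₀`
# with the SAME constants `E(L), a₀(L), S₀(L)` — the bootstrap «runs from the guarded height downward UNCHANGED»

Cell `ym3-torus` (YM ladder rung R3 = continuum `SU(2)` Yang–Mills on the three-torus at fixed lattice data — a RUNG: NOT d = 4, NOT infinite volume, NOT a mass gap,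
NOT Clay).  Width seat «width 5» `ym3-torus-px5` (gen 24), FREE px helper on crux `stmt-QuantumFields-20520`; `--kind proof --supports stmt-QuantumFields-20520 --as
helper`, count-neutral, DEFINITION-FREE (0 `def`, 0 `instance`, 0 `notation`, 0 `sorry`; ONE decl-local `set_option maxHeartbeats 400000 in` on §1, as in the ✓ theorem it re-runs).

WHY (LEAD w3 g29 №21 «D-GUARD QUANTIFIED» 2026-08-31 22:59:31Z; desk RULING №115 «D-GUARD-Q», (LS) = open debt by name).  ✓`…RelativeTowerSupBudgetTheta.exists_supBudget_128_theta`
(px12 g26) — the root of the ARC-PROFILE letter feeding the supplier knit's `hARC` socket (✓p836564) through ✓p835602 `arcLetter_of_guard` — takes its START from the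
DATUM: `arc(Vd e) ≤ 1∕128` at every bond of `Vd : GaugeField (F.P J) 0 SU2`, transported to the top `Ū^{K−J}U = Vd` of the stage tower by the fibre.  On the classes with
`N_J = 2L^{F.m+J} < 128π` that start is NOT reachable by ANY gauge for near-flat data with O(1) holonomy (UV3-NODE §90 toron obstruction; №21's numbers), and №21's cure
shape «LATE START» begins: «the ✓ bootstrap runs from level `K−J−i₀` downward UNCHANGED».  THIS FILE is that sentence by kernel, and nothing more: the bootstrap's engine
✓`exists_supProfile_relativeTower_start` is already stated for an ABSTRACT tower `U′ : (t : ℕ) → GaugeField P t SU2` of any top height `m` with the start «`s m ≤ σ` for every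
`σ` bounding the top's arcs», so the ✓ theorem's 110-line proof re-runs VERBATIM with `K − J ↦ T₀`, the gauged stage tower `↦ Us`, and the datum start `↦` a guard AT HEIGHT `T₀`.

WHAT IS PROVED (sorry-free; constants `NP, G, A₁, A₂, C₂, r₀, M, Smax, q, E, a₀, S₀` IDENTICAL to the ✓ theorem's).
§1 ★★★ `exists_supBudget_128_theta_segment (L) (hL : 1 < L)` — THE SEGMENT EDITION: `∃ E ≥ 0, ∃ a₀ > 0, ∃ S₀ > 0, ∀ F θ′, F.L = L → θ′ ≥ 0 → θ′ ≤ a₀ → ∀ K T₀ (hT₀ : T₀ ≤ F.m + K),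
  Σ_{i<T₀} θ′(K−i) ≤ S₀ → ∀ Us w V ⟨(W) hat weights, (LIFT) `V t = lift(Us (t+1))`, (T4) comb axiality of `Us t` w.r.t. `V t`, (T5) `avgFun ℰp (Us t) = Us (t+1)` — all for `t < T₀`⟩,
  (∀ t ≤ T₀, PlaqSmall (θ′(K−t)) (Us t)) → (GUARD AT HEIGHT `T₀`: ∀ b, ‖logVec (su2Quat (Us T₀ b))‖ ≤ 1∕128) →
  ∃ s ≥ 0, (∀ t ≤ T₀, ∀ b, ‖logVec (su2Quat (Us t b))‖ ≤ s t) ∧ (∀ t ≤ T₀, s t ≤ ¼) ∧ Σ_{t<T₀} s(t+1) ≤ E ∧ Σ_{t<T₀} s(t+1)² ≤ E`.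
§2 ★★★ `exists_supBudget_128_theta_lateStart (L) (hL)` — THE LATE-START EDITION IN THE ✓ THEOREM'S OWN FRAME: the hat-lift stage tower `t ↦ g_t • Ū^t U` of a good history
  `U ∈ histGood F ℰp θ′ K J` (clauses (W), (LIFT), (T4), (T5) for `t < K − J`, as in the ✓ theorem; NO `g_{K−J} = 1`, NO fibre), ANY `T₀ ≤ K − J`, the guard on the GAUGED
  LEVEL `g_{T₀} • Ū^{T₀} U` ⟹ the sup profile on `t ≤ T₀` with the same `E, a₀, S₀` (§1 at `Us t := g_t • Ū^t U`; `PlaqSmall` by gauge invariance from `histGood`).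
CONSISTENCY (no theorem — the gate's `dedup.landed` guard: it would restate the ✓ theorem).  At `T₀ := K − J` with the trivial top gauge `g_j = 1` (`K − J ≤ j`) and
  `U ∈ fibre(Vd)`, the datum guard `arc(Vd e) ≤ 1∕128` IS §2's height-`(K−J)` guard (✓`norm_logVec_iter_le_of_mem_fibre` + lit ✓`gaugeAct_const_one`), and §2 returns the
  ✓ theorem's conclusion VERBATIM (checked rc 0 in the seat's twin, then deleted): the segment edition SUBSUMES the datum edition — «UNCHANGED» by kernel.

DOMAIN SENTENCE (RULING №115 R5).  All `(F.m, J, K)` and every `T₀` (`≤ F.m + K` in §1, `≤ K − J` in §2); the theorems do NOT supply the height-`T₀` guard — on the classes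
`F.m + J ≤ 4` (`L = 3`) it is the business of №21's un-typed top-`i₀` letter (or of a height floor), NOT of this file; where the datum guard holds (`G_{s₀}`-guarded data,
`N_J ≥ 128π`) the consistency remark above = the ✓ road unchanged.

HONEST SCOPE.  A re-quantification of a landed proof (its text re-run with the top height free); nothing of Bałaban's renormalisation-group analysis is asserted or proved
([Balaban1985RegularSpaces] Lemma 1 (1.24)–(1.26) p.79, (1.29) p.81 — the printed small-field axial-gauge regularity these sup profiles transcribe; [Balaban1985Averaging]
Prop. 4 (128)–(135) pp.37–38); the top-`i₀` letter of «LATE START», the ARC-PROFILE letter's late-start edition, `hARC⁗`, `hDBX⁗`, D-GUARD, (ST⁗)∕LOC⁗, GAP♯∘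
(`stub_uniformFibreGapOrbit`, registry 3732b7df UNTOUCHED), the five registered stubs (0∕5), S2β, 20520, 19936, 19200, `YM3TorusSU2` are NOT proved; no registered
stub is closed; rung R3 — NOT d = 4, NOT infinite volume, NOT a mass gap, NOT Clay; the Yang–Mills mass gap is NOT proved.
-/

set_option autoImplicit false

noncomputable section

namespace Summit.QuantumFields.YangMills.Theorems.FluctuationComparisonRegPrIntLS2BetaTowerSegmentSupBudgetTheta

open Finset
open scoped Real
open Literature.MathematicalPhysics.QuantumLattice (su2Quat)
open Literature.MathematicalPhysics.QuantumFieldTheory.Balaban1983to89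
open T4Continuum T3ContinuumYM3Torus T3UnitScaleTilt T3TiltDescent T3LevelShift BlockAveraging
open T4CubeChartGnomonic (SU2)
open T4HaarSU2ExpChart (expPoint)
open T4ExpWindowSmallField (logVec)
open T3UnitLawDensityEML (ℰp)
open B10Eq27TorusAxialLog (rel axialT)
open Summit.QuantumFields.YangMills.Theorems.FluctuationComparisonRegPrIntLS2BetaRelativeTowerSupProfileStart (exists_supProfile_relativeTower_start)
open Summit.QuantumFields.YangMills.Theorems.FluctuationComparisonRegPrIntLS2BetaContractingSupStart
  (sq_budget_of_start linearised_of_bootstrap_start sum_succ_le_of_contract_start)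
open Summit.QuantumFields.YangMills.Theorems.FluctuationComparisonRegPrIntLS2BetaRelativeTowerSupBudget128 (one_div_128_le_ceiling)

/-! ## §1 The segment edition: an abstract averaging tower, the guard at its top height `T₀` -/

set_option maxHeartbeats 400000 in
/-- ★★★ **THE SUP BUDGET OF A TOWER SEGMENT IN THE EXPLICIT GUARD `1∕128`, θ-GENERIC** (the late-start edition of ✓`exists_supBudget_128_theta`): there are constants
`E(L) ≥ 0`, `a₀(L) > 0`, `S₀(L) > 0` such that for ANY threshold profile `θ′ ≥ 0` with every level `≤ a₀`, ANY top height `T₀ ≤ F.m + K` with `Σ_{i<T₀} θ′(K−i) ≤ S₀`, and ANY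
tower `Us t : GaugeField (F.P K) t SU2` whose levels below `T₀` are linked by the hat lift (W)∕(LIFT), the comb axiality (T4) and the averaging (T5), have `θ′(K−t)`-small
plaquettes (`t ≤ T₀`), and whose level `T₀` has every bond arc `≤ 1∕128`, there is a sup profile `s ≥ 0` of the levels `t ≤ T₀` with every level `≤ 1∕4`,
`Σ_{t<T₀} s(t+1) ≤ E` and `Σ_{t<T₀} s(t+1)² ≤ E` — depth- and volume-free.  Proof = the ✓ theorem's proof with `K − J ↦ T₀` and the datum start replaced by the
height-`T₀` guard (engine ✓`exists_supProfile_relativeTower_start`, bootstrap ✓`sq_budget_of_start`). [cite: Balaban1985RegularSpaces, Lemma 1 p.79, (1.29) p.81; Balaban1985Averaging, Prop. 4 (128)-(135) pp.37-38] -/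
theorem exists_supBudget_128_theta_segment (L : ℕ) (hL : 1 < L) :
    ∃ E : ℝ, 0 ≤ E ∧ ∃ a₀ : ℝ, 0 < a₀ ∧ ∃ S₀ : ℝ, 0 < S₀ ∧ ∀ (F : T3Family) (θ' : ℕ → ℝ), F.L = L → (∀ i, 0 ≤ θ' i) → (∀ i, θ' i ≤ a₀) →
      ∀ (K T₀ : ℕ), T₀ ≤ F.m + K → ∑ i ∈ range T₀, θ' (K - i) ≤ S₀ →
      ∀ (Us : (t : ℕ) → GaugeField (F.P K) t SU2) (w : (t : ℕ) → PBond (F.P K) t → PBond (F.P K) (t + 1) → ℝ)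
        (V : (t : ℕ) → GaugeField (F.P K) t SU2),
        (∀ t, t < T₀ → ∀ b e, w t b e = if e.dir = b.dir ∧ (b.src b.dir - emb e.src b.dir).val < (F.P K).L then
          ∏ ν ∈ Finset.univ.erase b.dir, max 0 (1 - ((rel (emb e.src) b.src ν).natAbs : ℝ) / (F.P K).L) else 0) →
        (∀ t, t < T₀ → ∀ b, V t b = expPoint (∑ e, w t b e • ((((F.P K).L : ℕ) : ℝ)⁻¹ • logVec (su2Quat (Us (t + 1) e))))) →
        (∀ t, t < T₀ → ∀ z : Site (F.P K) t, axialT (Us t) (emb (blockOf z)) z = axialT (V t) (emb (blockOf z)) z) →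
        (∀ t, t < T₀ → avgFun ℰp (Us t) = Us (t + 1)) →
        (∀ t, t ≤ T₀ → PlaqSmall (θ' (K - t)) (Us t)) →
        (∀ b : PBond (F.P K) T₀, ‖logVec (su2Quat (Us T₀ b))‖ ≤ 1 / 128) →
        ∃ s : ℕ → ℝ, (∀ t, 0 ≤ s t) ∧
          (∀ t, t ≤ T₀ → ∀ b, ‖logVec (su2Quat (Us t b))‖ ≤ s t) ∧
          (∀ t, t ≤ T₀ → s t ≤ 1 / 4) ∧ ∑ t ∈ range T₀, s (t + 1) ≤ E ∧ ∑ t ∈ range T₀, s (t + 1) ^ 2 ≤ E := by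
  -- the constants of the one-level step at `d = 3`, block size `L` (px17's) — VERBATIM from ✓`exists_supBudget_128_theta`
  have hL' : (1 : ℝ) < L := by exact_mod_cast hL
  have hL0 : (0 : ℝ) < L := by linarith
  obtain ⟨NP, hNP⟩ : ∃ x : ℝ, x = (((3 - 1) * ((L - 1) / 2) * (L + 1) : ℕ) : ℝ) := ⟨_, rfl⟩
  obtain ⟨G, hG⟩ : ∃ x : ℝ, x = ((((3 + 2) * L : ℕ) : ℝ) ^ 2 / 4) := ⟨_, rfl⟩
  have hNP0 : 0 ≤ NP := by rw [hNP]; positivity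
  have hG0 : 0 < G := by rw [hG]; positivity
  obtain ⟨A₁, hA₁⟩ : ∃ x : ℝ, x = π / 2 * (NP + 2 * G) := ⟨_, rfl⟩
  obtain ⟨A₂, hA₂⟩ : ∃ x : ℝ, x = π / 2 * (NP * ((L : ℝ)⁻¹) ^ 2 * (π / 2)) := ⟨_, rfl⟩
  obtain ⟨C₂, hC₂⟩ : ∃ x : ℝ, x = π / 2 * NP * 24 * ((L : ℝ)⁻¹) ^ 2 := ⟨_, rfl⟩
  obtain ⟨r₀, hr₀⟩ : ∃ x : ℝ, x = (L : ℝ)⁻¹ := ⟨_, rfl⟩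
  have hA₁0 : 0 ≤ A₁ := by rw [hA₁]; positivity
  have hA₂0 : 0 ≤ A₂ := by rw [hA₂]; positivity
  have hC₂0 : 0 ≤ C₂ := by rw [hC₂]; positivity
  have hr00 : 0 ≤ r₀ := by rw [hr₀]; positivity
  have hr01 : r₀ < 1 := by rw [hr₀]; exact inv_lt_one_of_one_lt₀ hL'
  have h1r : 0 < 1 - r₀ := by linarith
  -- the ceiling `M` and the threshold budget `Smax`
  obtain ⟨M, hM⟩ : ∃ x : ℝ, x = min (1 / 4) ((1 - r₀) / (2 * (C₂ + 1))) := ⟨_, rfl⟩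
  have hM0 : 0 < M := by rw [hM]; exact lt_min (by norm_num) (by positivity)
  have hM4 : M ≤ 1 / 4 := by rw [hM]; exact min_le_left _ _
  have hMC : C₂ * M ≤ (1 - r₀) / 2 := by
    have h1 : M ≤ (1 - r₀) / (2 * (C₂ + 1)) := by rw [hM]; exact min_le_right _ _
    calc C₂ * M ≤ (C₂ + 1) * ((1 - r₀) / (2 * (C₂ + 1))) := by nlinarith
      _ = (1 - r₀) / 2 := by field_simp
  obtain ⟨Smax, hSmax⟩ : ∃ x : ℝ, x = (1 - r₀) / 2 * M := ⟨_, rfl⟩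
  have hSmax0 : 0 < Smax := by rw [hSmax]; positivity
  -- the linearised ratio and the budget `E`
  obtain ⟨q, hq⟩ : ∃ x : ℝ, x = r₀ + C₂ * M := ⟨_, rfl⟩
  have hq0 : 0 ≤ q := by rw [hq]; positivity
  have hq1 : q < 1 := by rw [hq]; linarith
  obtain ⟨E, hE⟩ : ∃ x : ℝ, x = M * ((q * M + Smax) / (1 - q) + M) / 3 := ⟨_, rfl⟩
  have hE0 : 0 ≤ E := by
    rw [hE]
    have : 0 ≤ (q * M + Smax) / (1 - q) := div_nonneg (by positivity) (by linarith)
    positivity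
  -- the size guard for a single threshold: the `ℰp` guards (px17's `a₀`)
  have hδSU := ExpMeanLog.deltaSU_pos (n := Fin 2)
  obtain ⟨a₀, ha₀⟩ : ∃ x : ℝ, x = min (min (ExpMeanLog.deltaSU (Fin 2) / (2 * G)) (1 / (6 * G))) (Smax / (2 * (A₂ + 1))) := ⟨_, rfl⟩
  have ha₀0 : 0 < a₀ := by rw [ha₀]; exact lt_min (lt_min (by positivity) (by positivity)) (by positivity)
  obtain ⟨S₀, hS₀⟩ : ∃ x : ℝ, x = Smax / (2 * (A₁ + A₂ + 1)) := ⟨_, rfl⟩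
  have hS₀0 : 0 < S₀ := by rw [hS₀]; positivity
  -- the explicit guard: `1∕128 ≤ M(L)` for every `L ≥ 2` (`NP ≤ L² − 1`, `π < 3.15`)
  have h128 : (1 : ℝ) / 128 ≤ M := by rw [hM, hC₂, hr₀, hNP]; exact one_div_128_le_ceiling L hL
  have hEM0 : 0 ≤ 3 * E / M := by positivity
  refine ⟨3 * E / M, hEM0, a₀, ha₀0, S₀, hS₀0, fun F θ' hFL hθ0' hθa0 K T₀ hT₀ hθS Us w V hw hV hax hT5 hUg hσ' => ?_⟩
  have hPd : (F.P K).d = 3 := rfl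
  have hPL : (F.P K).L = L := hFL
  have hm : T₀ ≤ (F.P K).m + (F.P K).K := by show T₀ ≤ F.m + K; omega
  -- thresholds on the levels of the segment
  set θ : ℕ → ℝ := fun t => θ' (K - t) with hθ
  have hθ0 : ∀ t, 0 ≤ θ t := fun t => hθ0' _
  have hθa' : ∀ t, θ t ≤ a₀ := fun t => hθa0 _
  have hθU : ∀ t, t ≤ T₀ → PlaqSmall (θ t) (Us t) := fun t ht => hUg t ht
  -- the guards from `θ ≤ a₀`
  have hGa : G * a₀ < ExpMeanLog.deltaSU (Fin 2) ∧ G * a₀ ≤ 1 / 6 := by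
    have h1 : a₀ ≤ ExpMeanLog.deltaSU (Fin 2) / (2 * G) := by rw [ha₀]; exact (min_le_left _ _).trans (min_le_left _ _)
    have h2 : a₀ ≤ 1 / (6 * G) := by rw [ha₀]; exact (min_le_left _ _).trans (min_le_right _ _)
    constructor
    · calc G * a₀ ≤ G * (ExpMeanLog.deltaSU (Fin 2) / (2 * G)) := mul_le_mul_of_nonneg_left h1 hG0.le
        _ = ExpMeanLog.deltaSU (Fin 2) / 2 := by field_simp
        _ < ExpMeanLog.deltaSU (Fin 2) := by linarith
    · calc G * a₀ ≤ G * (1 / (6 * G)) := mul_le_mul_of_nonneg_left h2 hG0.le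
        _ = 1 / 6 := by field_simp
  have hg1 : ∀ t, t < T₀ → (((((F.P K).d + 2) * (F.P K).L : ℕ) : ℝ) ^ 2 / 4) * θ t < ExpMeanLog.deltaSU (Fin 2) := by
    intro t _; rw [hPd, hPL, ← hG]
    exact lt_of_le_of_lt (mul_le_mul_of_nonneg_left (hθa' t) hG0.le) hGa.1
  have hg2 : ∀ t, t < T₀ → (((((F.P K).d + 2) * (F.P K).L : ℕ) : ℝ) ^ 2 / 4) * θ t ≤ 1 / 6 := by
    intro t _; rw [hPd, hPL, ← hG]
    exact le_trans (mul_le_mul_of_nonneg_left (hθa' t) hG0.le) hGa.2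
  -- the general-top profile and its conditional quadratic step (the engine is stated for an abstract tower of any top height)
  obtain ⟨s, hsm, hs0, hsb, hstep⟩ := exists_supProfile_relativeTower_start hm Us w V hw hV hax hT5 θ hθ0 hθU hg1 hg2
  -- the START: the guard AT HEIGHT `T₀`, bond by bond (this is the only line that differs from the datum edition)
  have hstart : s T₀ ≤ M := hsm M fun b => (hσ' b).trans h128
  -- the step in the bootstrap's currency
  set ρ : ℕ → ℝ := fun t => A₁ * θ t + A₂ * θ (t + 1) with hρ
  have hρ0 : ∀ t, 0 ≤ ρ t := fun t => add_nonneg (mul_nonneg hA₁0 (hθ0 t)) (mul_nonneg hA₂0 (hθ0 _))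
  have hstep' : ∀ t, t < T₀ → s (t + 1) ≤ 1 / 4 → s t ≤ r₀ * s (t + 1) + ρ t + C₂ * s (t + 1) ^ 2 := by
    intro t ht h4
    have h := hstep t ht h4
    rw [hPd, hPL] at h
    refine h.trans (le_of_eq ?_)
    simp only [hρ, hA₁, hA₂, hC₂, hr₀, hNP, hG]
    ring
  -- the threshold sum: `Σ_{t<T₀} ρ t ≤ (A₁ + A₂)·Σθ + A₂·a₀ ≤ Smax` (px17's count verbatim)
  have hSρ : ∑ t ∈ range T₀, ρ t ≤ Smax := by
    have hs1 : ∑ t ∈ range T₀, ρ t =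
        A₁ * ∑ t ∈ range T₀, θ t + A₂ * ∑ t ∈ range T₀, θ (t + 1) := by
      simp only [hρ, sum_add_distrib, mul_sum]
    have hshift : ∑ t ∈ range T₀, θ (t + 1) ≤ ∑ t ∈ range T₀, θ t + a₀ := by
      rcases Nat.eq_zero_or_pos T₀ with h0 | hpos
      · rw [h0]; simp [ha₀0.le]
      · obtain ⟨m, hm'⟩ : ∃ m, T₀ = m + 1 := ⟨T₀ - 1, by omega⟩
        rw [hm', Finset.sum_range_succ' θ, Finset.sum_range_succ (fun t => θ (t + 1))]
        have := hθ0 0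
        have := hθa' (m + 1)
        linarith
    have hmain : (A₁ + A₂) * ∑ i ∈ range T₀, θ' (K - i) ≤ Smax / 2 := by
      have hA0 : 0 ≤ A₁ + A₂ := by positivity
      calc (A₁ + A₂) * ∑ i ∈ range T₀, θ' (K - i) ≤ (A₁ + A₂) * S₀ := mul_le_mul_of_nonneg_left hθS hA0
        _ ≤ (A₁ + A₂ + 1) * S₀ := mul_le_mul_of_nonneg_right (by linarith) hS₀0.le
        _ = Smax / 2 := by rw [hS₀]; field_simp
    have hθsum0 : 0 ≤ ∑ t ∈ range T₀, θ t := sum_nonneg fun t _ => hθ0 t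
    have ha₀S : A₂ * a₀ ≤ Smax / 2 := by
      have h3 : a₀ ≤ Smax / (2 * (A₂ + 1)) := by rw [ha₀]; exact min_le_right _ _
      calc A₂ * a₀ ≤ A₂ * (Smax / (2 * (A₂ + 1))) := mul_le_mul_of_nonneg_left h3 hA₂0
        _ ≤ (A₂ + 1) * (Smax / (2 * (A₂ + 1))) := mul_le_mul_of_nonneg_right (by linarith) (by positivity)
        _ = Smax / 2 := by field_simp
    rw [hs1]
    have hA₂sh := mul_le_mul_of_nonneg_left hshift hA₂0
    calc A₁ * ∑ t ∈ range T₀, θ t + A₂ * ∑ t ∈ range T₀, θ (t + 1)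
        ≤ A₁ * ∑ t ∈ range T₀, θ t + A₂ * (∑ t ∈ range T₀, θ t + a₀) := by linarith
      _ = (A₁ + A₂) * ∑ i ∈ range T₀, θ' (K - i) + A₂ * a₀ := by simp only [hθ]; ring
      _ ≤ Smax / 2 + Smax / 2 := add_le_add hmain ha₀S
      _ = Smax := by ring
  -- the bootstrap from the start (✓`sq_budget_of_start`)
  have hsmall₁ : Smax ≤ (1 - r₀) / 2 * M := by rw [hSmax]
  obtain ⟨hall, hsq⟩ := sq_budget_of_start s ρ T₀ r₀ C₂ (1 / 4) M Smax hstart hs0 hρ0 hSρ hstep' hr00 hr01 hC₂0 hM4 hsmall₁ hMC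
  obtain ⟨hq0', hq1', hlin⟩ :=
    linearised_of_bootstrap_start s ρ T₀ r₀ C₂ (1 / 4) M Smax hstart hs0 hρ0 hSρ hstep' hr00 hr01 hC₂0 hM4 hsmall₁ hMC
  have hl1 := sum_succ_le_of_contract_start _ hq0' hq1' s ρ T₀ hs0 hlin
  -- `(q·s_top + Σρ)∕(1 − q) + s_top ≤ (q·M + Smax)∕(1 − q) + M = 3E∕M`
  rw [← hq] at hsq hl1
  have h1q : 0 < 1 - q := by linarith
  have hnum : q * s T₀ + ∑ t ∈ range T₀, ρ t ≤ q * M + Smax := add_le_add (mul_le_mul_of_nonneg_left hstart hq0) hSρ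
  have hdiv : (q * s T₀ + ∑ t ∈ range T₀, ρ t) / (1 - q) ≤ (q * M + Smax) / (1 - q) := div_le_div_of_nonneg_right hnum h1q.le
  have hbound : (q * s T₀ + ∑ t ∈ range T₀, ρ t) / (1 - q) + s T₀ ≤ 3 * E / M := by
    rw [le_div_iff₀ hM0, hE]
    calc ((q * s T₀ + ∑ t ∈ range T₀, ρ t) / (1 - q) + s T₀) * M
        ≤ ((q * M + Smax) / (1 - q) + M) * M := mul_le_mul_of_nonneg_right (add_le_add hdiv hstart) hM0.le
      _ = 3 * (M * ((q * M + Smax) / (1 - q) + M) / 3) := by ring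
  have hM1 : M ≤ 1 := hM4.trans (by norm_num)
  have h3E : 3 * E ≤ 3 * E / M := by
    rw [le_div_iff₀ hM0]
    nlinarith [hE0]
  refine ⟨s, hs0, hsb, fun t ht => (hall t ht).trans hM4, hl1.trans hbound, (hsq.trans ?_).trans h3E⟩
  calc M * ((q * s T₀ + ∑ t ∈ range T₀, ρ t) / (1 - q) + s T₀)
      ≤ M * (3 * E / M) := mul_le_mul_of_nonneg_left hbound hM0.le
    _ = 3 * E := by field_simp

/-! ## §2 The late-start edition in the ✓ theorem's own frame: the hat-lift stage tower of a good history, the guard on the gauged level `T₀ ≤ K − J` -/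

/-- ★★★ **THE LATE-START SUP BUDGET OF THE STAGE TOWER** (✓`exists_supBudget_128_theta` with the datum guard `arc(Vd e) ≤ 1∕128` REPLACED by the same guard on the gauged
level `g_{T₀} • Ū^{T₀}U` at any height `T₀ ≤ K − J`, and the conclusion on the heights `t ≤ T₀`): same constants `E, a₀, S₀`; the tower clauses (W), (LIFT), (T4), (T5) are the
✓ theorem's VERBATIM (all `t < K − J`), the history is `U ∈ histGood F ℰp θ′ K J` (plaquette windows at every constrained height; `PlaqSmall` passes to the gauged levels by
gauge invariance), the threshold window is `Σ_{i<T₀} θ′(K−i) ≤ S₀`; NO `g_{K−J} = 1`, NO fibre membership.  Proof: §1 at `Us t := g_t • Ū^t U`. [cite: Balaban1985RegularSpaces, Lemma 1 p.79, (1.29) p.81; Balaban1985Averaging, Prop. 4 (128)-(135) pp.37-38] -/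
theorem exists_supBudget_128_theta_lateStart (L : ℕ) (hL : 1 < L) :
    ∃ E : ℝ, 0 ≤ E ∧ ∃ a₀ : ℝ, 0 < a₀ ∧ ∃ S₀ : ℝ, 0 < S₀ ∧ ∀ (F : T3Family) (θ' : ℕ → ℝ), F.L = L → (∀ i, 0 ≤ θ' i) → (∀ i, θ' i ≤ a₀) →
      ∀ (J K : ℕ), J ≤ K → ∀ (T₀ : ℕ), T₀ ≤ K - J → ∑ i ∈ range T₀, θ' (K - i) ≤ S₀ →
      ∀ (U : GaugeField (F.P K) 0 SU2), U ∈ histGood F ℰp θ' K J →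
      ∀ (g : (j : ℕ) → Site (F.P K) j → SU2) (w : (t : ℕ) → PBond (F.P K) t → PBond (F.P K) (t + 1) → ℝ)
        (V : (t : ℕ) → GaugeField (F.P K) t SU2),
        (∀ t, t < K - J → ∀ b e, w t b e = if e.dir = b.dir ∧ (b.src b.dir - emb e.src b.dir).val < (F.P K).L then
          ∏ ν ∈ Finset.univ.erase b.dir, max 0 (1 - ((rel (emb e.src) b.src ν).natAbs : ℝ) / (F.P K).L) else 0) →
        (∀ t, t < K - J → ∀ b, V t b = expPoint (∑ e, w t b e • ((((F.P K).L : ℕ) : ℝ)⁻¹ •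
          logVec (su2Quat (GaugeField.gaugeAct (g (t + 1)) (Averaging.iter (fun k => blockAvg (P := F.P K) (j := k) ℰp) (t + 1) U) e))))) →
        (∀ t, t < K - J → ∀ z : Site (F.P K) t,
          axialT (GaugeField.gaugeAct (g t) (Averaging.iter (fun k => blockAvg (P := F.P K) (j := k) ℰp) t U)) (emb (blockOf z)) z =
            axialT (V t) (emb (blockOf z)) z) →
        (∀ t, t < K - J → avgFun ℰp (GaugeField.gaugeAct (g t) (Averaging.iter (fun k => blockAvg (P := F.P K) (j := k) ℰp) t U)) =
          GaugeField.gaugeAct (g (t + 1)) (Averaging.iter (fun k => blockAvg (P := F.P K) (j := k) ℰp) (t + 1) U)) →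
        (∀ b : PBond (F.P K) T₀,
          ‖logVec (su2Quat (GaugeField.gaugeAct (g T₀) (Averaging.iter (fun k => blockAvg (P := F.P K) (j := k) ℰp) T₀ U) b))‖ ≤ 1 / 128) →
        ∃ s : ℕ → ℝ, (∀ t, 0 ≤ s t) ∧
          (∀ t, t ≤ T₀ → ∀ b, ‖logVec (su2Quat (GaugeField.gaugeAct (g t) (Averaging.iter (fun k => blockAvg (P := F.P K) (j := k) ℰp) t U) b))‖ ≤ s t) ∧
          (∀ t, t ≤ T₀ → s t ≤ 1 / 4) ∧ ∑ t ∈ range T₀, s (t + 1) ≤ E ∧ ∑ t ∈ range T₀, s (t + 1) ^ 2 ≤ E := by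
  obtain ⟨E, hE0, a₀, ha₀0, S₀, hS₀0, H⟩ := exists_supBudget_128_theta_segment L hL
  refine ⟨E, hE0, a₀, ha₀0, S₀, hS₀0, fun F θ' hFL hθ0' hθa0 J K hJK T₀ hT₀ hθS U hUg g w V hw hV hax hT5 hσ' => ?_⟩
  -- the gauged stage tower as an abstract tower; its plaquettes are those of `Ū^t U` up to conjugation
  have hθU : ∀ t, t ≤ T₀ → PlaqSmall (θ' (K - t))
      (GaugeField.gaugeAct (g t) (Averaging.iter (fun k => blockAvg (P := F.P K) (j := k) ℰp) t U)) := by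
    intro t ht p
    rw [T4ReTrLipUnitary.plaqHol_gaugeAct, GaugeGroup.dist1_conj]
    exact hUg t (by omega) p
  exact H F θ' hFL hθ0' hθa0 K T₀ (by omega) hθS
    (fun t => GaugeField.gaugeAct (g t) (Averaging.iter (fun k => blockAvg (P := F.P K) (j := k) ℰp) t U)) w V
    (fun t ht => hw t (by omega)) (fun t ht => hV t (by omega)) (fun t ht => hax t (by omega)) (fun t ht => hT5 t (by omega))
    hθU hσ'

end Summit.QuantumFields.YangMills.Theorems.FluctuationComparisonRegPrIntLS2BetaTowerSegmentSupBudgetTheta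

end
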